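import Mathlib
import Summits.ValiantsHypothesis.ValiantsHypothesis.Theorems.NewtonUnitEquationsDissociatedUniformTotalsLawChartLevels
import Summits.ValiantsHypothesis.ValiantsHypothesis.Theorems.NewtonUnitEquationsDissociatedUniformTotalsLawChartLevelsTopSets
import Summits.ValiantsHypothesis.ValiantsHypothesis.Theorems.NewtonUnitEquationsDissociatedUniformTotalsLawChartLevelsPairs
import Literature.Computability.AlgebraicComplexity.NewtonPolygonTauProductBounds
import HarnessLib

/-!
# Crux `NewtonUnitEquations.DissociatedUniform` (stmt-ValiantsHypothesis-5905): totals law — top-`k` sets and CELLS off the low-event times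

Tool file for the `k`-shallow vertex theorem `…TotalsLawKShallow` (graded form of `…TotalsLawShallow`).  Along the chart `t ↦ (σ, t)`
of a finite planar set `F` (`rank`, `topSet`, `IsLowEvent`, `lowEvents`, `cellIdx` of `…ChartLevels*`):
* `rank_lt_rank_of_lt` — a strictly lower point has strictly larger rank;
* **`card_topSet_le_of_forall_ne`** — if no low tie event of order `< k` happens at time `t` then `#topSet σ F k t ≤ k` (pigeonhole on
  ranks: two members of equal rank have equal scores, i.e. tie with `< k` points above — a low event); no genericity needed;
* **`topSet_eq_of_cellIdx_eq'`** — if all low-event times lie in `T`, two times OFF `T` with the same cell index have the same top-`k`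
  set (variant of `…ChartLevelsPairs.topSet_eq_of_cellIdx_eq` with "off `T`" in place of genericity, via `exists_lowEvent_of_topSet_ne`);
* `cellIdx_mono`, `cellIdx_le_card`, **`cells_ordered`** — the cells `{t ∉ T : cellIdx T t = i}` are pairwise time-ordered (so the
  ordered-family count `…ChartTops.sum_card_chartTops_le` applies to them).
Honest label: tool lemmas only; nothing here bears on VP ≠ VNP.
[folklore: levels in arrangements of lines]
-/

set_option linter.dupNamespace false -- `ValiantsHypothesis.ValiantsHypothesis` (summit = problem) in every name

open scoped BigOperators
open Matrix Finset

namespace Summit.ValiantsHypothesis.ValiantsHypothesis.Theorems.NewtonUnitEquationsDissociatedUniform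

namespace TotalsLaw

open Literature.Computability.AlgebraicComplexity.KPTT.PlanarMinkowski

/-! ### Top-`k` sets off the low-event times -/

section TopK

variable {σ : ℝ} {F : Finset (Fin 2 → ℝ)}

/-- A strictly lower point has strictly larger rank. [folklore] -/
theorem rank_lt_rank_of_lt {t : ℝ} {p q : Fin 2 → ℝ} (hq : q ∈ F)
    (hlt : ![σ, t] ⬝ᵥ p < ![σ, t] ⬝ᵥ q) : rank σ F t q < rank σ F t p := by
  classical
  unfold rank
  refine Finset.card_lt_card ⟨fun y hy => ?_, fun hsub => ?_⟩
  · obtain ⟨hyF, hylt⟩ := Finset.mem_filter.1 hy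
    exact Finset.mem_filter.2 ⟨hyF, hlt.trans hylt⟩
  · have hq' : q ∈ F.filter fun y => ![σ, t] ⬝ᵥ p < ![σ, t] ⬝ᵥ y := Finset.mem_filter.2 ⟨hq, hlt⟩
    have := (Finset.mem_filter.1 (hsub hq')).2
    exact lt_irrefl _ this

/-- **Off the low-event times the top-`k` set has at most `k` members**: if no low tie event of order `< k` happens at time `t`,
then `#topSet σ F k t ≤ k` (two members of equal rank would tie with fewer than `k` points above). [folklore] -/
theorem card_topSet_le_of_forall_ne {k : ℕ} {t : ℝ} (ht : ∀ e : ℝ × ℝ, IsLowEvent σ F k e → e.1 ≠ t) :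
    (topSet σ F k t).card ≤ k := by
  classical
  by_contra h
  push Not at h
  have hmaps : Set.MapsTo (rank σ F t) (topSet σ F k t : Set (Fin 2 → ℝ)) (Finset.range k : Set ℕ) := by
    intro p hp
    have hp' := Finset.mem_filter.1 (Finset.mem_coe.1 hp)
    exact Finset.mem_coe.2 (Finset.mem_range.2 hp'.2)
  obtain ⟨p, hp, q, hq, hpq, hr⟩ :=
    Finset.exists_ne_map_eq_of_card_lt_of_maps_to (by rw [Finset.card_range]; exact h) hmaps
  obtain ⟨hpF, hpk⟩ := Finset.mem_filter.1 hp
  obtain ⟨hqF, -⟩ := Finset.mem_filter.1 hq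
  -- equal ranks force equal scores
  have heq : ![σ, t] ⬝ᵥ p = ![σ, t] ⬝ᵥ q := by
    by_contra hne
    rcases lt_or_gt_of_ne hne with hlt | hlt
    · exact absurd hr (ne_of_gt (rank_lt_rank_of_lt hqF hlt))
    · exact absurd hr (ne_of_lt (rank_lt_rank_of_lt hpF hlt))
  -- the low event `(t, score p)`
  apply ht (t, ![σ, t] ⬝ᵥ p) ?_ rfl
  refine ⟨?_, ?_⟩
  · have hsub : ({p, q} : Finset (Fin 2 → ℝ)) ⊆ tied σ F t (![σ, t] ⬝ᵥ p) := by
      intro y hy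
      rw [Finset.mem_insert, Finset.mem_singleton] at hy
      unfold tied
      rcases hy with rfl | rfl
      · exact Finset.mem_filter.2 ⟨hpF, rfl⟩
      · exact Finset.mem_filter.2 ⟨hqF, heq.symm⟩
    calc 2 = ({p, q} : Finset (Fin 2 → ℝ)).card := (Finset.card_pair hpq).symm
      _ ≤ _ := Finset.card_le_card hsub
  · have : above σ F t (![σ, t] ⬝ᵥ p) = F.filter fun y => ![σ, t] ⬝ᵥ p < ![σ, t] ⬝ᵥ y := rfl
    change (above σ F t (![σ, t] ⬝ᵥ p)).card < k
    rw [this]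
    exact hpk

/-- **Same cell, same top set (off the event times).**  If all low-event times of order `< k` lie in `T` and `t, t' ∉ T` have the same
cell index, the top-`k` sets agree (variant of `…ChartLevelsPairs.topSet_eq_of_cellIdx_eq` without genericity). [folklore] -/
theorem topSet_eq_of_cellIdx_eq' {k : ℕ} {T : Finset ℝ} (hT : ∀ e, IsLowEvent σ F k e → e.1 ∈ T) {t t' : ℝ}
    (ht : t ∉ T) (ht' : t' ∉ T) (hc : cellIdx T t = cellIdx T t') : topSet σ F k t = topSet σ F k t' := by
  classical
  have key : ∀ u u' : ℝ, u ≤ u' → u ∉ T → u' ∉ T → cellIdx T u = cellIdx T u' →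
      topSet σ F k u = topSet σ F k u' := by
    intro u u' huu hu hu' hcu
    by_contra hne
    obtain ⟨e, he, h1, h2⟩ := exists_lowEvent_of_topSet_ne huu hne
    have heT : e.1 ∈ T := hT e he
    have hne1 : e.1 ≠ u := fun h => hu (h ▸ heT)
    have hne2 : e.1 ≠ u' := fun h => hu' (h ▸ heT)
    have hlt1 : u < e.1 := lt_of_le_of_ne h1 (Ne.symm hne1)
    have hlt2 : e.1 < u' := lt_of_le_of_ne h2 hne2
    have hsub : T.filter (fun v => v < u) ⊆ T.filter (fun v => v < u') := by
      intro v hv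
      obtain ⟨hvT, hvu⟩ := Finset.mem_filter.1 hv
      exact Finset.mem_filter.2 ⟨hvT, hvu.trans_le huu⟩
    have hmem : e.1 ∈ T.filter (fun v => v < u') := Finset.mem_filter.2 ⟨heT, hlt2⟩
    have hnmem : e.1 ∉ T.filter (fun v => v < u) := fun h => by
      have := (Finset.mem_filter.1 h).2
      linarith
    have hlt : cellIdx T u < cellIdx T u' := Finset.card_lt_card ⟨hsub, fun h => hnmem (h hmem)⟩
    omega
  rcases le_total t t' with h | h
  · exact key t t' h ht ht' hc
  · exact (key t' t h ht' ht hc.symm).symm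

/-- The cell index is monotone in time. [folklore] -/
theorem cellIdx_mono (T : Finset ℝ) {t t' : ℝ} (h : t ≤ t') : cellIdx T t ≤ cellIdx T t' := by
  classical
  unfold cellIdx
  exact Finset.card_le_card fun v hv => by
    obtain ⟨hvT, hvt⟩ := Finset.mem_filter.1 hv
    exact Finset.mem_filter.2 ⟨hvT, hvt.trans_le h⟩

/-- The cell index is at most `#T`. [folklore] -/
theorem cellIdx_le_card (T : Finset ℝ) (t : ℝ) : cellIdx T t ≤ T.card := by
  classical
  unfold cellIdx
  exact Finset.card_filter_le _ _

/-- Cells (time sets of equal cell index) are pairwise time-ordered. [folklore] -/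
theorem cells_ordered (T : Finset ℝ) {i j : ℕ} (hij : i ≠ j) :
    (∀ t ∈ {t : ℝ | t ∉ T ∧ cellIdx T t = i}, ∀ t' ∈ {t : ℝ | t ∉ T ∧ cellIdx T t = j}, t < t') ∨
      (∀ t ∈ {t : ℝ | t ∉ T ∧ cellIdx T t = i}, ∀ t' ∈ {t : ℝ | t ∉ T ∧ cellIdx T t = j}, t' < t) := by
  rcases lt_or_gt_of_ne hij with h | h
  · left
    intro t ht t' ht'
    by_contra hle
    push Not at hle
    have := cellIdx_mono T hle
    rw [ht.2, ht'.2] at this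
    omega
  · right
    intro t ht t' ht'
    by_contra hle
    push Not at hle
    have := cellIdx_mono T hle
    rw [ht.2, ht'.2] at this
    omega

end TopK

end TotalsLaw

end Summit.ValiantsHypothesis.ValiantsHypothesis.Theorems.NewtonUnitEquationsDissociatedUniform
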